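import Summits.BirchSwinnertonDyer.BirchSwinnertonDyer.Theorems.UniversalToricDescentReceptacleUntwist
import Summits.BirchSwinnertonDyer.Rank1Residual.X11b.RouteR1IntReceptacle
import HarnessLib

/-!
# Route `UniversalToricDescent`, ♭B column (♭B′ `TwinWanFrameAtThreeMultTresT`, stmt-BirchSwinnertonDyer-27401), line `membertower`:
# the SHAPE of the member congruence — Castella's PRINTED two-sided ideal form `(Q) + (π) = (L) + (π)` versus the UNIT form
# `Q ≡ u·L (mod π)` of the registered research stub `stub_memberInclusionMultUnitCong` (v9, clause (K2′))

Cell `bsd-wall` (run/shared/lean/pub/bsd-wall/), width seat `bsd-wall-utd-p2-w2` (g4, 2026-08-28), for the LEAD `bsd-wall-utd-p2` (g13,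
membertower v9 `ce07c90788d2daec` / v10). `--supports stmt-BirchSwinnertonDyer-27401 --as helper`; Theses-free; pure commutative algebra
plus two `p`-adic instances. Nothing about BSD is asserted or proved here.

## What and why

In print the member congruence (c) of [Castella2018Erratum, proof of Thm. 1.1 (p. 4)] ∕ [Castella2020JIMJ, Thm. 2.11] is an EQUALITY OF
IDEALS `(L^Σ_p(g_m), p^m) = (L^Σ_p(f), p^m)`; the tree types it so for `p ≥ 5` (the last clause of
`Literature.NumberTheory.EllipticCurves.Castella2018.erratum_exists_frames_members_sigma_congruence`:
`span {Qm} ⊔ span {C p^m} = span {a(L·j P_Σ)} ⊔ span {C p^m}` in `𝓞_{ℂ_p}⟦T⟧`). The `p = 3` line `membertower` (v9) asks instead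
for a UNIT congruence `∃ u, IsUnit u ∧ Q − u·L ∈ (3^m)` (needed there because clause (K1) is only RATIONAL: the one-sided ideal
form `Q ∈ (L) + (3^m)` would admit `Q ∈ (3^m)` and say nothing). This file shows the two shapes are THE SAME in every receptacle the
line uses:

* §1 `span_sup_eq_of_sub_mul_mem` — unit form ⟹ two-sided ideal form (any commutative ring, any `c ∈ S⟦T⟧`).
* §2 `exists_isUnit_sub_mul_mem_of_span_sup_eq` — two-sided ideal form ⟹ unit form, over a commutative ring `S` with `π` in the
  Jacobson radical (`1 + π s` always a unit) and `L` having a unit coefficient in degree `d` above coefficients that are NILPOTENT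
  modulo `π`. Proof: `Q = αL + πβ`, `L = α′Q + πβ′` ⟹ `(1 − α′α)·L ∈ (π)`; modulo `π`, `L̄` is a non-zero-divisor (w2 g3's
  `X11b.PowerSeries.eq_zero_of_mul_eq_zero_of_isUnit_coeff_of_isNilpotent_lt`, p629455) ⟹ `α′α ≡ 1 (mod π)` ⟹ the constant
  coefficient of `α` is a unit (Jacobson) ⟹ `α ∈ S⟦T⟧ˣ`; take `u := α`.
* §3 `…_of_isLocalRing` — the same for `S` LOCAL with `π ∈ 𝔪 ⊆ √(π)` and `μ(L) = 0` (`∃ i, IsUnit (coeff i L)`); μ-TRANSFER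
  `isUnit_coeff_of_sub_mul_mem`: under the unit form the FIRST unit coefficient of `L` sits in the same degree in `Q` (so the member's
  `μ = 0` is free — no Hsieh-Thm-B-in-weight-`k` input is needed for it).
* §4 instances: `𝓞_{ℂ_p}` with `π = p^m` (`…_padicComplexInt`, the receptacle of the typed weight-`k` frames `IsBDPLFunctionWtSigmaInt`
  and of the LEAD's norm descent p631025) and any DVR containing `π ≠ 0` in its maximal ideal (`…_of_isDiscreteValuationRing`: `ℤ_p`,
  `𝒪_m`, `R₀` via `X2.isDiscreteValuationRing_unrIntegers`).

CONSEQUENCE (for v10 ∕ the typer): clause (K2″) may be typed VERBATIM in Castella's printed shape at `p = 3` — the unit form consumed by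
`RoadFFSaturation.twin_exists_forall_C_pow_mul_mem_span_of_unitCongMemberTower_of_isTorsion` (p629725) is then kernel.
HONEST FRAMING: theorems of commutative algebra; no statement item is closed; BSD is proved for no curve.

References: [Castella2018Erratum] proof of Thm. 1.1 (c) (p. 4); [Castella2020JIMJ] Thm. 2.11; [Skinner2016PacificMC] §3.1 (c), (2.5)_m
(p. 192); [AtiyahMacdonald1969] Prop. 1.9 (Jacobson radical), Ch. 1 Ex. 5 (units of power series rings); [Washington1997] §7.1.
-/

set_option autoImplicit false

noncomputable section

open scoped Classical

open PowerSeries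

namespace Summit.BirchSwinnertonDyer.Rank1Residual.X11b.CongruenceShape

section General

variable {S : Type*} [CommRing S]

/-! ### §0 Spellings -/

/-- `(p : S⟦T⟧)^m = C (p^m)` — the stub's spelling `((3 : ℕ) : PowerSeries S₀) ^ m` versus this file's `C π`. [folklore] -/
theorem natCast_pow_eq_C_pow (p m : ℕ) : ((p : S⟦X⟧)) ^ m = C (((p : ℕ) : S) ^ m) := by
  rw [map_pow, map_natCast]

/-- If the coefficients of `φ` below degree `d` vanish, then `coeff d (ψ·φ) = coeff 0 ψ · coeff d φ`. [folklore] -/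
theorem coeff_mul_eq_of_coeff_lt_eq_zero (ψ φ : S⟦X⟧) (d : ℕ) (h : ∀ i < d, coeff i φ = 0) :
    coeff d (ψ * φ) = coeff 0 ψ * coeff d φ := by
  rw [coeff_mul, Finset.sum_eq_single (0, d)]
  · intro ij hij hne
    have hsum : ij.1 + ij.2 = d := Finset.HasAntidiagonal.mem_antidiagonal.mp hij
    have hj : ij.2 < d := by
      rcases Nat.lt_or_ge ij.2 d with hlt | hge
      · exact hlt
      · exfalso
        have h2 : ij.2 = d := le_antisymm (by omega) hge
        have h1 : ij.1 = 0 := by omega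
        exact hne (Prod.ext h1 h2)
    rw [h _ hj, mul_zero]
  · intro hnot
    exact absurd (Finset.HasAntidiagonal.mem_antidiagonal.mpr (by simp)) hnot

/-! ### §1 Unit form ⟹ two-sided ideal form -/

/-- **Unit congruence ⟹ equality of ideals modulo `c`**: if `Q − u·L ∈ (c)` with `u` a unit of `S⟦T⟧` then
`(Q) + (c) = (L) + (c)`. [cite: Castella2018Erratum, proof of Thm. 1.1 (c) (p. 4) (the printed shape)] -/
theorem span_sup_eq_of_sub_mul_mem {c Q L u : S⟦X⟧} (hu : IsUnit u) (h : Q - u * L ∈ Ideal.span {c}) :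
    Ideal.span {Q} ⊔ Ideal.span {c} = Ideal.span {L} ⊔ Ideal.span {c} := by
  obtain ⟨v, hv⟩ := hu
  apply le_antisymm
  · rw [sup_le_iff]
    refine ⟨?_, le_sup_right⟩
    rw [Ideal.span_singleton_le_iff_mem]
    have hQ : Q = u * L + (Q - u * L) := by ring
    rw [hQ]
    exact Submodule.add_mem_sup (Ideal.mem_span_singleton'.mpr ⟨u, rfl⟩) h
  · rw [sup_le_iff]
    refine ⟨?_, le_sup_right⟩
    rw [Ideal.span_singleton_le_iff_mem]
    set w : S⟦X⟧ := ((v⁻¹ : (S⟦X⟧)ˣ) : S⟦X⟧) with hw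
    have hwu : w * u = 1 := by rw [hw, ← hv, Units.inv_mul]
    have hL : L = w * Q - w * (Q - u * L) := by linear_combination (-L) * hwu
    rw [hL]
    exact Submodule.sub_mem _ (Submodule.mem_sup_left (Ideal.mem_span_singleton'.mpr ⟨w, rfl⟩))
      (Submodule.mem_sup_right (Ideal.mul_mem_left _ w h))

/-! ### §2 Two-sided ideal form ⟹ unit form (Jacobson hypothesis on `π`, unit coefficient above nilpotents) -/

/-- **Equality of ideals modulo `π` ⟹ unit congruence.** `S` a commutative ring, `π ∈ S` with `1 + π s` a unit for every `s`
(`π` in the Jacobson radical), `L ∈ S⟦T⟧` with a unit coefficient in degree `d` and coefficients NILPOTENT modulo `π` below `d`.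
If `(Q) + (π) = (L) + (π)` then `Q − u·L ∈ (π)` for a unit `u` of `S⟦T⟧`.
(`Q = αL + βπ`, `L = α′Q + β′π` ⟹ `(1 − α′α)L ∈ (π)` ⟹ `α′α ≡ 1 (mod π)` since `L mod π` is a non-zero-divisor ⟹ `α(0)` is a unit.)
[cite: AtiyahMacdonald1969, Prop. 1.9 and Ch. 1 Ex. 5] [cite: Castella2018Erratum, proof of Thm. 1.1 (c) (p. 4)] -/
theorem exists_isUnit_sub_mul_mem_of_span_sup_eq {π : S} (hπ : ∀ s : S, IsUnit (1 + π * s)) {Q L : S⟦X⟧} (d : ℕ)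
    (hd : IsUnit (coeff d L)) (hlow : ∀ i < d, IsNilpotent (Ideal.Quotient.mk (Ideal.span {π}) (coeff i L)))
    (h : Ideal.span {Q} ⊔ Ideal.span {C π} = Ideal.span {L} ⊔ Ideal.span {C π}) :
    ∃ u : S⟦X⟧, IsUnit u ∧ Q - u * L ∈ Ideal.span {C π} := by
  -- `Q = αL + β·Cπ`, `L = α′Q + β′·Cπ`
  have hQ : Q ∈ Ideal.span {L} ⊔ Ideal.span {C π} := by
    rw [← h]; exact Submodule.mem_sup_left (Ideal.mem_span_singleton_self Q)
  have hL : L ∈ Ideal.span {Q} ⊔ Ideal.span {C π} := by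
    rw [h]; exact Submodule.mem_sup_left (Ideal.mem_span_singleton_self L)
  obtain ⟨α, z, hz, e1⟩ := Ideal.mem_span_singleton_sup.mp hQ
  obtain ⟨β, rfl⟩ := Ideal.mem_span_singleton'.mp hz
  obtain ⟨α', z', hz', e2⟩ := Ideal.mem_span_singleton_sup.mp hL
  obtain ⟨β', rfl⟩ := Ideal.mem_span_singleton'.mp hz'
  -- `(1 − α′α)·L = Cπ·(α′β + β′)`
  have hkey : L * (1 - α' * α) = C π * (α' * β + β') := by linear_combination (-α') * e1 - e2
  -- reduce modulo `π`
  set red := PowerSeries.map (Ideal.Quotient.mk (Ideal.span {π})) with hred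
  have hredπ : red (C π) = 0 := by
    rw [hred, map_C, Ideal.Quotient.eq_zero_iff_mem.mpr (Ideal.mem_span_singleton_self π), map_zero]
  have hzero : red L * red (1 - α' * α) = 0 := by rw [← map_mul, hkey, map_mul, hredπ, zero_mul]
  have hunit : IsUnit (coeff d (red L)) := by
    rw [hred, coeff_map]; exact hd.map _
  have hnil : ∀ i < d, IsNilpotent (coeff i (red L)) := by
    intro i hi; rw [hred, coeff_map]; exact hlow i hi
  have hvan : red (1 - α' * α) = 0 :=
    X11b.PowerSeries.eq_zero_of_mul_eq_zero_of_isUnit_coeff_of_isNilpotent_lt (red L) d hunit hnil _ hzero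
  -- constant coefficients: `1 − α′(0)α(0) ∈ (π)`
  have hconst : Ideal.Quotient.mk (Ideal.span {π}) (constantCoeff (1 - α' * α)) = 0 := by
    have h0 := congrArg (coeff 0) hvan
    rwa [hred, coeff_map, map_zero, coeff_zero_eq_constantCoeff_apply] at h0
  rw [Ideal.Quotient.eq_zero_iff_mem, map_sub, map_one, map_mul, Ideal.mem_span_singleton'] at hconst
  obtain ⟨s, hs⟩ := hconst
  have hprod : IsUnit (constantCoeff α' * constantCoeff α) := by
    have heq : constantCoeff α' * constantCoeff α = 1 + π * (-s) := by linear_combination hs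
    rw [heq]; exact hπ (-s)
  have hα : IsUnit α := by
    rw [isUnit_iff_constantCoeff]
    exact isUnit_of_mul_isUnit_right hprod
  refine ⟨α, hα, ?_⟩
  have hdiff : Q - α * L = β * C π := by linear_combination (-1 : S⟦X⟧) * e1
  rw [hdiff]
  exact Ideal.mem_span_singleton'.mpr ⟨β, rfl⟩

/-! ### §3 Local rings: `π ∈ 𝔪 ⊆ √(π)` and `μ(L) = 0` -/

/-- In a local ring, `1 + x` is a unit for `x ∈ 𝔪`. [cite: AtiyahMacdonald1969, Prop. 1.9] -/
theorem isUnit_one_add_of_mem_maximalIdeal [IsLocalRing S] {x : S} (hx : x ∈ IsLocalRing.maximalIdeal S) :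
    IsUnit (1 + x) := by
  by_contra h
  have hmem : (1 + x) ∈ IsLocalRing.maximalIdeal S := (IsLocalRing.mem_maximalIdeal _).mpr h
  have h1 : (1 : S) ∈ IsLocalRing.maximalIdeal S := by
    have := Submodule.sub_mem _ hmem hx
    rwa [add_sub_cancel_right] at this
  exact (IsLocalRing.maximalIdeal.isMaximal S).ne_top (Ideal.eq_top_of_isUnit_mem _ h1 isUnit_one)

/-- **Two-sided ideal form ⟹ unit form in a LOCAL receptacle.** `S` local, `π ∈ 𝔪`, every element of `𝔪` having a power
divisible by `π` (`𝔪 ⊆ √(π)`), `L ∈ S⟦T⟧` with some unit coefficient (`μ(L) = 0`). If `(Q) + (π) = (L) + (π)` then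
`Q − u·L ∈ (π)` for a unit `u`. [cite: Castella2018Erratum, proof of Thm. 1.1 (c) (p. 4)] [cite: AtiyahMacdonald1969, Prop. 1.9] -/
theorem exists_isUnit_sub_mul_mem_of_span_sup_eq_of_isLocalRing [IsLocalRing S] {π : S}
    (hπ : π ∈ IsLocalRing.maximalIdeal S) (hrad : ∀ x ∈ IsLocalRing.maximalIdeal S, ∃ n : ℕ, π ∣ x ^ n)
    {Q L : S⟦X⟧} (hμ : ∃ i : ℕ, IsUnit (coeff i L))
    (h : Ideal.span {Q} ⊔ Ideal.span {C π} = Ideal.span {L} ⊔ Ideal.span {C π}) :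
    ∃ u : S⟦X⟧, IsUnit u ∧ Q - u * L ∈ Ideal.span {C π} := by
  have hJ : ∀ s : S, IsUnit (1 + π * s) := fun s ↦
    isUnit_one_add_of_mem_maximalIdeal (Ideal.mul_mem_right s _ hπ)
  set d := Nat.find hμ with hddef
  have hd : IsUnit (coeff d L) := Nat.find_spec hμ
  have hlow : ∀ i < d, IsNilpotent (Ideal.Quotient.mk (Ideal.span {π}) (coeff i L)) := by
    intro i hi
    have hni : ¬ IsUnit (coeff i L) := Nat.find_min hμ hi
    obtain ⟨n, hn⟩ := hrad _ ((IsLocalRing.mem_maximalIdeal _).mpr hni)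
    exact ⟨n, by rw [← map_pow, Ideal.Quotient.eq_zero_iff_mem, Ideal.mem_span_singleton]; exact hn⟩
  exact exists_isUnit_sub_mul_mem_of_span_sup_eq hJ d hd hlow h

/-- The two shapes are EQUIVALENT in a local receptacle with `π ∈ 𝔪 ⊆ √(π)` and `μ(L) = 0`.
[cite: Castella2018Erratum, proof of Thm. 1.1 (c) (p. 4)] [cite: Skinner2016PacificMC, §3.1 (c), (2.5)_m (p. 192)] -/
theorem span_sup_eq_iff_exists_isUnit_sub_mul_mem_of_isLocalRing [IsLocalRing S] {π : S}
    (hπ : π ∈ IsLocalRing.maximalIdeal S) (hrad : ∀ x ∈ IsLocalRing.maximalIdeal S, ∃ n : ℕ, π ∣ x ^ n)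
    {Q L : S⟦X⟧} (hμ : ∃ i : ℕ, IsUnit (coeff i L)) :
    Ideal.span {Q} ⊔ Ideal.span {C π} = Ideal.span {L} ⊔ Ideal.span {C π} ↔
      ∃ u : S⟦X⟧, IsUnit u ∧ Q - u * L ∈ Ideal.span {C π} :=
  ⟨exists_isUnit_sub_mul_mem_of_span_sup_eq_of_isLocalRing hπ hrad hμ,
    fun ⟨_, hu, hmem⟩ ↦ span_sup_eq_of_sub_mul_mem hu hmem⟩

/-- **μ-transfer along a unit congruence (local receptacle).** `S` local, `π ∈ 𝔪`, `Q − u·L ∈ (π)` with `u` a unit, `L` with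
its FIRST unit coefficient in degree `d` (coefficients below `d` in `𝔪`). Then `coeff d Q` is a unit — the member's `μ = 0`
comes for free with the congruence. [cite: Skinner2016PacificMC, §3.1 (c) (p. 192)] [cite: Washington1997, §7.1] -/
theorem isUnit_coeff_of_sub_mul_mem [IsLocalRing S] {π : S} (hπ : π ∈ IsLocalRing.maximalIdeal S)
    {Q L u : S⟦X⟧} (hu : IsUnit u) (h : Q - u * L ∈ Ideal.span {C π}) (d : ℕ) (hd : IsUnit (coeff d L))
    (hlow : ∀ i < d, coeff i L ∈ IsLocalRing.maximalIdeal S) : IsUnit (coeff d Q) := by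
  obtain ⟨β, hβ⟩ := Ideal.mem_span_singleton'.mp h
  set red := PowerSeries.map (IsLocalRing.residue S) with hred
  have hredπ : red (C π) = 0 := by
    rw [hred, map_C, (IsLocalRing.residue_eq_zero_iff π).mpr hπ, map_zero]
  have hQ : red Q = red u * red L := by
    have hQ' : Q = u * L + β * C π := by linear_combination (-1 : S⟦X⟧) * hβ
    rw [hQ', map_add, map_mul, map_mul, hredπ, mul_zero, add_zero]
  have hlow' : ∀ i < d, coeff i (red L) = 0 := by
    intro i hi
    rw [hred, coeff_map, IsLocalRing.residue_eq_zero_iff]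
    exact hlow i hi
  have hcoeff : coeff d (red Q) = coeff 0 (red u) * coeff d (red L) := by
    rw [hQ]; exact coeff_mul_eq_of_coeff_lt_eq_zero _ _ d hlow'
  have hu0 : IsUnit (coeff 0 (red u)) := by
    rw [coeff_zero_eq_constantCoeff_apply, ← isUnit_iff_constantCoeff]; exact hu.map _
  have hL0 : IsUnit (coeff d (red L)) := by rw [hred, coeff_map]; exact hd.map _
  have hprod : IsUnit (coeff d (red Q)) := by rw [hcoeff]; exact hu0.mul hL0
  rw [hred, coeff_map] at hprod
  by_contra hnot
  have hmem : coeff d Q ∈ IsLocalRing.maximalIdeal S := (IsLocalRing.mem_maximalIdeal _).mpr hnot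
  rw [(IsLocalRing.residue_eq_zero_iff _).mpr hmem] at hprod
  exact not_isUnit_zero hprod

/-- **μ-transfer along the two-sided ideal form (local receptacle with `𝔪 ⊆ √(π)`)**: if `(Q) + (π) = (L) + (π)` and `L` has a unit
coefficient then so does `Q` (in the degree of `L`'s first unit coefficient). [cite: Skinner2016PacificMC, §3.1 (c) (p. 192)] -/
theorem exists_isUnit_coeff_of_span_sup_eq_of_isLocalRing [IsLocalRing S] {π : S}
    (hπ : π ∈ IsLocalRing.maximalIdeal S) (hrad : ∀ x ∈ IsLocalRing.maximalIdeal S, ∃ n : ℕ, π ∣ x ^ n)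
    {Q L : S⟦X⟧} (hμ : ∃ i : ℕ, IsUnit (coeff i L))
    (h : Ideal.span {Q} ⊔ Ideal.span {C π} = Ideal.span {L} ⊔ Ideal.span {C π}) :
    ∃ i : ℕ, IsUnit (coeff i Q) := by
  obtain ⟨u, hu, hmem⟩ := exists_isUnit_sub_mul_mem_of_span_sup_eq_of_isLocalRing hπ hrad hμ h
  refine ⟨Nat.find hμ, isUnit_coeff_of_sub_mul_mem hπ hu hmem _ (Nat.find_spec hμ) fun i hi ↦ ?_⟩
  exact (IsLocalRing.mem_maximalIdeal _).mpr (Nat.find_min hμ hi)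

/-! ### §4a Discrete valuation rings (`ℤ_p`, `𝒪_m`, `R₀`) -/

/-- In a DVR, every element of `𝔪` has a power divisible by any given non-zero `π` (`𝔪 = √(π)`).
[cite: SerreLocalFields1979, Ch. I §1] -/
theorem exists_dvd_pow_of_mem_maximalIdeal_of_isDiscreteValuationRing [IsDomain S] [IsDiscreteValuationRing S]
    {π : S} (hπ0 : π ≠ 0) (x : S) (hx : x ∈ IsLocalRing.maximalIdeal S) : ∃ n : ℕ, π ∣ x ^ n := by
  by_cases hx0 : x = 0
  · exact ⟨1, by rw [hx0, pow_one]; exact dvd_zero π⟩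
  obtain ⟨ϖ, hϖ⟩ := IsDiscreteValuationRing.exists_irreducible S
  obtain ⟨a, u, hxu⟩ := IsDiscreteValuationRing.eq_unit_mul_pow_irreducible hx0 hϖ
  obtain ⟨b, v, hπv⟩ := IsDiscreteValuationRing.eq_unit_mul_pow_irreducible hπ0 hϖ
  have ha : 1 ≤ a := by
    by_contra ha0
    have ha0' : a = 0 := by omega
    rw [ha0', pow_zero, mul_one] at hxu
    exact ((IsLocalRing.mem_maximalIdeal _).mp hx) (hxu ▸ Units.isUnit u)
  refine ⟨b, ?_⟩
  rw [hxu, hπv, mul_pow, ← pow_mul]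
  exact (Units.isUnit v).mul_left_dvd.mpr
    (((Units.isUnit u).pow b).dvd_mul_left.mpr (pow_dvd_pow ϖ (Nat.le_mul_of_pos_left b ha)))

/-- **Two shapes, one congruence — DVR receptacles** (`ℤ_p`, the member's `𝒪_m`, `R₀`): for `π ≠ 0` in the maximal ideal and
`μ(L) = 0`, `(Q) + (π) = (L) + (π) ↔ ∃ u unit, Q − u·L ∈ (π)`. [cite: Castella2018Erratum, proof of Thm. 1.1 (c) (p. 4)] -/
theorem span_sup_eq_iff_exists_isUnit_sub_mul_mem_of_isDiscreteValuationRing [IsDomain S] [IsDiscreteValuationRing S]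
    {π : S} (hπ0 : π ≠ 0) (hπ : π ∈ IsLocalRing.maximalIdeal S) {Q L : S⟦X⟧} (hμ : ∃ i : ℕ, IsUnit (coeff i L)) :
    Ideal.span {Q} ⊔ Ideal.span {C π} = Ideal.span {L} ⊔ Ideal.span {C π} ↔
      ∃ u : S⟦X⟧, IsUnit u ∧ Q - u * L ∈ Ideal.span {C π} :=
  span_sup_eq_iff_exists_isUnit_sub_mul_mem_of_isLocalRing hπ
    (exists_dvd_pow_of_mem_maximalIdeal_of_isDiscreteValuationRing hπ0) hμ

end General

/-! ### §4b The receptacle `𝓞_{ℂ_p}` with `π = p^m` -/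

section PadicComplexInt

open Literature.NumberTheory.LFunctions

variable {p : ℕ} [Fact p.Prime]

/-- `‖p‖ = p⁻¹ < 1` in `ℂ_p`, read on the image of `(p : ℕ)` in `𝓞_{ℂ_p}`. [folklore] -/
theorem norm_coe_natCast_padicComplexInt : ‖(((p : ℕ) : 𝓞_ℂ_[p]) : ℂ_[p])‖ = (p : ℝ)⁻¹ := by
  have hp : (((p : ℕ) : 𝓞_ℂ_[p]) : ℂ_[p]) = ((p : ℚ_[p]) : ℂ_[p]) := by simp
  rw [hp, PadicComplex.norm_extends']
  exact Padic.norm_p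

/-- In `𝓞_{ℂ_p}`, every non-unit has a power divisible by `p^m` (`‖x‖ < 1 ⟹ ‖x^n‖ ≤ p^{-m}` for `n ≫ 0`; divisibility from the norm
inequality in the valuation ring). [cite: Washington1997, §7.1] -/
theorem padicComplexInt_exists_pow_dvd_pow_of_mem_maximalIdeal (m : ℕ) (x : 𝓞_ℂ_[p])
    (hx : x ∈ IsLocalRing.maximalIdeal 𝓞_ℂ_[p]) : ∃ n : ℕ, (((p : ℕ) : 𝓞_ℂ_[p]) ^ m) ∣ x ^ n := by
  have hxu : ¬ IsUnit x := (IsLocalRing.mem_maximalIdeal _).mp hx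
  have hlt : ‖(x : ℂ_[p])‖ < 1 :=
    lt_of_le_of_ne (R1.norm_coe_padicComplexInt_le_one p x) (fun h ↦ hxu (Dwork.isUnit_unitBall_of_norm_eq_one h))
  have hp0 : (0 : ℝ) < (p : ℝ)⁻¹ := inv_pos.mpr (Nat.cast_pos.mpr (Fact.out : p.Prime).pos)
  have hpos : (0 : ℝ) < ((p : ℝ)⁻¹) ^ m := pow_pos hp0 m
  obtain ⟨n, hn⟩ := exists_pow_lt_of_lt_one hpos hlt
  refine ⟨n, ?_⟩
  -- `‖x^n‖ ≤ ‖p^m‖` ⟹ `p^m ∣ x^n`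
  set y : 𝓞_ℂ_[p] := ((p : ℕ) : 𝓞_ℂ_[p]) ^ m with hy
  have hyn : ‖(y : ℂ_[p])‖ = ((p : ℝ)⁻¹) ^ m := by
    rw [hy, SubmonoidClass.coe_pow, norm_pow, norm_coe_natCast_padicComplexInt]
  have hnorm : ‖((x ^ n : 𝓞_ℂ_[p]) : ℂ_[p])‖ ≤ ‖(y : ℂ_[p])‖ := by
    rw [SubmonoidClass.coe_pow, norm_pow, hyn]
    exact hn.le
  have hy0 : (y : ℂ_[p]) ≠ 0 := by
    intro h0
    rw [h0, norm_zero] at hyn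
    exact (pow_pos hp0 m).ne hyn
  have hq : ((x ^ n : 𝓞_ℂ_[p]) : ℂ_[p]) / (y : ℂ_[p]) ∈ 𝓞_ℂ_[p] := by
    refine Dwork.mem_unitBall.mpr ?_
    rw [norm_div]
    exact div_le_one_of_le₀ hnorm (norm_nonneg _)
  refine ⟨⟨_, hq⟩, Subtype.ext ?_⟩
  change ((x ^ n : 𝓞_ℂ_[p]) : ℂ_[p]) = (y : ℂ_[p]) * (((x ^ n : 𝓞_ℂ_[p]) : ℂ_[p]) / (y : ℂ_[p]))
  rw [mul_div_cancel₀ _ hy0]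

/-- `p^m` (with `m ≥ 1`) lies in the maximal ideal of `𝓞_{ℂ_p}`. [folklore] -/
theorem padicComplexInt_natCast_pow_mem_maximalIdeal {m : ℕ} (hm : 1 ≤ m) :
    (((p : ℕ) : 𝓞_ℂ_[p]) ^ m) ∈ IsLocalRing.maximalIdeal 𝓞_ℂ_[p] := by
  rw [IsLocalRing.mem_maximalIdeal, mem_nonunits_iff]
  intro hu
  have h1 : ‖((((p : ℕ) : 𝓞_ℂ_[p]) ^ m : 𝓞_ℂ_[p]) : ℂ_[p])‖ = 1 := by
    obtain ⟨u, hu'⟩ := hu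
    rw [← hu']
    exact R1.norm_coe_units_padicComplexInt p u
  rw [SubmonoidClass.coe_pow, norm_pow, norm_coe_natCast_padicComplexInt] at h1
  have hp1 : (p : ℝ)⁻¹ < 1 := inv_lt_one_of_one_lt₀ (by exact_mod_cast (Fact.out : p.Prime).one_lt)
  exact (pow_lt_one₀ (inv_nonneg.mpr (Nat.cast_nonneg p)) hp1 (by omega)).ne h1

/-- **Two shapes, one congruence — the receptacle `𝓞_{ℂ_p}⟦T⟧.** For `L ∈ 𝓞_{ℂ_p}⟦T⟧` with a unit coefficient (`μ(L) = 0`) and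
every `m`: `(Q) + (p^m) = (L) + (p^m) ↔ ∃ u unit, Q − u·L ∈ (p^m)` — Castella's printed (c) versus clause (K2′) of
`stub_memberInclusionMultUnitCong`. [cite: Castella2018Erratum, proof of Thm. 1.1 (c) (p. 4)] [cite: Castella2020JIMJ, Thm. 2.11] -/
theorem span_sup_eq_iff_exists_isUnit_sub_mul_mem_padicComplexInt (m : ℕ) {Q L : PowerSeries 𝓞_ℂ_[p]}
    (hμ : ∃ i : ℕ, IsUnit (coeff i L)) :
    Ideal.span {Q} ⊔ Ideal.span {C ((((p : ℕ) : 𝓞_ℂ_[p]) ^ m))} =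
        Ideal.span {L} ⊔ Ideal.span {C ((((p : ℕ) : 𝓞_ℂ_[p]) ^ m))} ↔
      ∃ u : PowerSeries 𝓞_ℂ_[p], IsUnit u ∧ Q - u * L ∈ Ideal.span {C ((((p : ℕ) : 𝓞_ℂ_[p]) ^ m))} := by
  rcases Nat.eq_zero_or_pos m with hm | hm
  · -- `m = 0`: both sides are trivially true
    subst hm
    have htop : Ideal.span {C ((((p : ℕ) : 𝓞_ℂ_[p]) ^ 0))} = (⊤ : Ideal (PowerSeries 𝓞_ℂ_[p])) := by
      rw [pow_zero, map_one, Ideal.span_singleton_one]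
    simp only [htop, sup_top_eq, Submodule.mem_top, and_true, true_iff]
    exact ⟨1, isUnit_one⟩
  · exact span_sup_eq_iff_exists_isUnit_sub_mul_mem_of_isLocalRing (padicComplexInt_natCast_pow_mem_maximalIdeal hm)
      (padicComplexInt_exists_pow_dvd_pow_of_mem_maximalIdeal m) hμ

/-- The direction the line consumes, in the stub's spelling `((p : ℕ) : S⟦T⟧)^m`: from Castella's printed (c) in `𝓞_{ℂ_p}⟦T⟧` and
`μ(L) = 0`, a UNIT `u` with `Q − u·L ∈ (p^m)`. [cite: Castella2018Erratum, proof of Thm. 1.1 (c) (p. 4)] [cite: Castella2020JIMJ, Thm. 2.11] -/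
theorem exists_isUnit_sub_mul_mem_padicComplexInt (m : ℕ) {Q L : PowerSeries 𝓞_ℂ_[p]}
    (hμ : ∃ i : ℕ, IsUnit (coeff i L))
    (h : Ideal.span {Q} ⊔ Ideal.span {((p : ℕ) : PowerSeries 𝓞_ℂ_[p]) ^ m} =
      Ideal.span {L} ⊔ Ideal.span {((p : ℕ) : PowerSeries 𝓞_ℂ_[p]) ^ m}) :
    ∃ u : PowerSeries 𝓞_ℂ_[p], IsUnit u ∧ Q - u * L ∈ Ideal.span {((p : ℕ) : PowerSeries 𝓞_ℂ_[p]) ^ m} := by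
  rw [natCast_pow_eq_C_pow] at h ⊢
  exact (span_sup_eq_iff_exists_isUnit_sub_mul_mem_padicComplexInt m hμ).mp h

/-- μ-transfer in `𝓞_{ℂ_p}⟦T⟧`: under Castella's (c) with `m ≥ 1`, `μ(L) = 0 ⟹ μ(Q) = 0` (a unit coefficient of `Q` in the degree of
`L`'s first unit coefficient). [cite: Skinner2016PacificMC, §3.1 (c) (p. 192)] -/
theorem exists_isUnit_coeff_of_span_sup_eq_padicComplexInt {m : ℕ} (hm : 1 ≤ m) {Q L : PowerSeries 𝓞_ℂ_[p]}
    (hμ : ∃ i : ℕ, IsUnit (coeff i L))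
    (h : Ideal.span {Q} ⊔ Ideal.span {C ((((p : ℕ) : 𝓞_ℂ_[p]) ^ m))} =
      Ideal.span {L} ⊔ Ideal.span {C ((((p : ℕ) : 𝓞_ℂ_[p]) ^ m))}) :
    ∃ i : ℕ, IsUnit (coeff i Q) :=
  exists_isUnit_coeff_of_span_sup_eq_of_isLocalRing (padicComplexInt_natCast_pow_mem_maximalIdeal hm)
    (padicComplexInt_exists_pow_dvd_pow_of_mem_maximalIdeal m) hμ h

end PadicComplexInt

end Summit.BirchSwinnertonDyer.Rank1Residual.X11b.CongruenceShape

end
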